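import Summits.KontsevichZagierPeriods.KontsevichZagierPeriods.Theses.MellinCoarea
import Summits.KontsevichZagierPeriods.KontsevichZagierPeriods.Theorems.MzvKernelInKZ.Negative.ScalingDivision
import Literature.NumberTheory.Transcendental.KZKernelConjectureForms

/-!
# Strategy census for `FibrewiseTransfer` (stmt-KontsevichZagierPeriods-5081) — Lean evidence

Crux-strategist re-audit (RESTATED bin) of the deciding crux `FibrewiseTransfer` of route
`MellinCoarea`.  This file TYPES every candidate decomposition `X₁ ∧ … ∧ X_k → FibrewiseTransfer`
recorded in `STRATEGY-CENSUS.md` and proves, for each, the fact that disqualifies it under the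
BC2-redirect certificate (a) load-bearing / (b) assembly proved AND non-trivial / (c) no piece
equivalent to `FibrewiseTransfer` (= `X`) or to the summit `S`:

* D1  fibre-dimension filtration `X = ⋀ₖ Stratum k`:
  - `summit_of_tailGE` — every tail piece `⋀_{k ≥ K} Stratum k` is ALREADY the summit (pad by slabs),
    so a finite cut by strata needs an implication-shaped residual;
  - `fibrewiseTransfer_of_strata` — with the residual `StepResidual := ∀ k ≥ 1, Stratum k → Stratum (k+1)`
    the assembly IS `Nat.rec` (4 lines): a trivial seam, (b) fails.
* D2  rational ∧ torsion-free: `ftRat_iff` — the rational piece is EQUIVALENT to `X` because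
  torsion-freeness of `FormalRep ⧸ relations` is a tree theorem (`mem_relations_of_nsmul_mem`); (c) fails.
* D3  "adjoin the k = 1 sector as a fifth rule": `kzPeriodConjecture'_of_residual` — the seam between the
  residual and `RelTransferOne` is cut-elimination (`AddSubgroup.closure_le`, 6 lines); (b) fails, and the
  residual is the summit modulo the sector (`residual_of_kzPeriodConjecture'`).
* consequence directions `S′ → piece` recorded where cheap.

Nothing here is filed as an item; the file elaborates sorry-free (see NOTES.md for the `lean check` record).
-/

noncomputable section

namespace Summit.KontsevichZagierPeriods.KontsevichZagierPeriods.Cruxes.FibrewiseTransfer.Census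

open MeasureTheory Set
open Literature.NumberTheory.Transcendental
open Summit.KontsevichZagierPeriods.KontsevichZagierPeriods.Theses.MellinCoarea

/-! ## D1 — the fibre-dimension filtration (the route's own seam) -/

/-- The stratum of fibre dimension `k` of `FibrewiseTransfer`, all base dimensions `b` at once. -/
def Stratum (k : ℕ) : Prop :=
  ∀ ⦃b : ℕ⦄ (r r' : KZ.IntegralRep (b + k)),
    (∀ᵐ x : (Fin b → ℝ),
      (∫ y in {y : Fin k → ℝ | Fin.append x y ∈ r.domain}, r.integrand (Fin.append x y))
        = ∫ y in {y : Fin k → ℝ | Fin.append x y ∈ r'.domain}, r'.integrand (Fin.append x y)) →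
    KZ.Equivalent r r'

/-- `FibrewiseTransfer` is the conjunction of its strata (definitional). -/
theorem fibrewiseTransfer_iff_forall_stratum : FibrewiseTransfer ↔ ∀ k, Stratum k :=
  ⟨fun h k _ r r' hf => h r r' hf, fun h _ k r r' hf => h k r r' hf⟩

/-- D1(a): a TAIL piece — all strata of fibre dimension `≥ K`. -/
def TailGE (K : ℕ) : Prop := ∀ k, K ≤ k → Stratum k

/-- Over the one-point base `Fin 0 → ℝ` the fibre integral of `R` is its value (the computation
inside the route's deciding theorem `closes`). -/
theorem fibre_integral_base_zero {k : ℕ} (R : KZ.IntegralRep (0 + k)) (x : Fin 0 → ℝ) :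
    ∫ y in {y : Fin k → ℝ | Fin.append x y ∈ R.domain}, R.integrand (Fin.append x y) = R.value := by
  let e : (Fin k → ℝ) ≃ᵐ (Fin (0 + k) → ℝ) :=
    (MeasurableEquiv.piCongrLeft (fun _ : Fin k => ℝ) (finCongr (Nat.zero_add k))).symm
  have he : MeasurePreserving e volume volume :=
    (volume_measurePreserving_piCongrLeft (fun _ : Fin k => ℝ) (finCongr (Nat.zero_add k))).symm _
  have happ : ∀ y : Fin k → ℝ, Fin.append x y = e y := by
    intro y
    rw [Fin.append_left_nil x y rfl]
    funext i
    rfl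
  simp only [happ]
  exact he.setIntegral_preimage_emb e.measurableEmbedding R.integrand R.domain

/-- **D1(a) is disqualified by (c): every tail is the summit.**  For every `K`, the strata of fibre
dimension `≥ K` at base `b = 0` already give Conjecture 1 for ALL pairs of representations: pad both
to the common dimension `max (max n m) K` by slabs (`KZ.IntegralRep.exists_equivalent_of_le`, values
kept by soundness) and read the one-point-base fibre integral as the value. -/
theorem kzPeriodConjecture'_of_tailGE (K : ℕ) (hT : TailGE K) : KZPeriodConjecture' := by
  intro n m r r' hv
  obtain ⟨R, hR⟩ := r.exists_equivalent_of_le (N := 0 + max (max n m) K)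
    (((le_max_left n m).trans (le_max_left _ K)).trans_eq (Nat.zero_add _).symm)
  obtain ⟨R', hR'⟩ := r'.exists_equivalent_of_le (N := 0 + max (max n m) K)
    (((le_max_right n m).trans (le_max_left _ K)).trans_eq (Nat.zero_add _).symm)
  have hvR : R.value = R'.value :=
    (KZ.Equivalent.value_eq_holds hR).symm.trans (hv.trans (KZ.Equivalent.value_eq_holds hR'))
  have key : KZ.Equivalent R R' :=
    hT (max (max n m) K) (le_max_right _ _) R R'
      (Filter.Eventually.of_forall fun x => by
        rw [fibre_integral_base_zero R x, fibre_integral_base_zero R' x, hvR])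
  exact hR.trans (key.trans hR'.symm)

/-- Hence every tail piece implies the summit statement itself (KZ-literal endpoints). -/
theorem summit_of_tailGE (K : ℕ) (hT : TailGE K) : KontsevichZagierPeriods :=
  kzPeriodConjecture'_iff_isRational.1 (kzPeriodConjecture'_of_tailGE K hT)

/-- D1(b): the implication-shaped residual — descent by one fibre dimension. -/
def StepResidual : Prop := ∀ k, 1 ≤ k → Stratum k → Stratum (k + 1)

/-- All strata from the two lowest ones and the step: plain recursion on `k`. -/
theorem stratum_all (h0 : Stratum 0) (h1 : Stratum 1) (hstep : StepResidual) : ∀ k, Stratum k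
  | 0 => h0
  | 1 => h1
  | (k + 2) => hstep (k + 1) (Nat.succ_pos k) (stratum_all h0 h1 hstep (k + 1))

/-- **D1(b) is disqualified by (b): the assembly is `Nat.rec`.**  The whole glue
`Stratum 0 → Stratum 1 → StepResidual → FibrewiseTransfer` is this term (four lines including
`stratum_all`); stating the two low strata in their native coordinates (`Fin.snoc`, Dirac mass on
`Fin 0 → ℝ`) only adds reindexing, not mathematics. -/
theorem fibrewiseTransfer_of_strata (h0 : Stratum 0) (h1 : Stratum 1) (hstep : StepResidual) :
    FibrewiseTransfer :=
  fibrewiseTransfer_iff_forall_stratum.2 (stratum_all h0 h1 hstep)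

/-- Consequence direction: the residual is implied by `FibrewiseTransfer` (its hypothesis is never
used — the degenerate reading that makes it "the strata `k ≥ 2` with a decorative hypothesis"). -/
theorem stepResidual_of_fibrewiseTransfer (h : FibrewiseTransfer) : StepResidual :=
  fun k _ _ => fibrewiseTransfer_iff_forall_stratum.1 h (k + 1)

/-! ## D2 — rational ∧ torsion-free -/

/-- D2 piece: `FibrewiseTransfer` up to a positive integer multiple (the `ℚ`-linear form in which
Kontsevich / Grothendieck / Ayoub state the period conjecture). -/
def FTRat : Prop :=
  ∀ ⦃b k : ℕ⦄ (r r' : KZ.IntegralRep (b + k)),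
    (∀ᵐ x : (Fin b → ℝ),
      (∫ y in {y : Fin k → ℝ | Fin.append x y ∈ r.domain}, r.integrand (Fin.append x y))
        = ∫ y in {y : Fin k → ℝ | Fin.append x y ∈ r'.domain}, r'.integrand (Fin.append x y)) →
    ∃ N : ℕ, 0 < N ∧ N • (KZ.of r - KZ.of r') ∈ KZ.relations

/-- **D2 is disqualified by (c): the rational piece is equivalent to `X`.**  Division by a positive
integer is a derived rule of integrand additivity (`[σ, f] = N • [σ, f / N]`), landed in tree as
`MzvKernelInKZ.Negative.mem_relations_of_nsmul_mem`; so `FormalRep ⧸ relations` is torsion-free and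
the would-be second piece is a theorem. -/
theorem ftRat_iff : FTRat ↔ FibrewiseTransfer := by
  constructor
  · intro h b k r r' hf
    obtain ⟨N, hN, hmem⟩ := h r r' hf
    exact Summit.KontsevichZagierPeriods.MzvKernelInKZ.Negative.mem_relations_of_nsmul_mem hN hmem
  · intro h b k r r' hf
    exact ⟨1, Nat.one_pos, by rw [one_nsmul]; exact h r r' hf⟩

/-! ## D3 — the `k = 1` sector adjoined as a fifth rule (enlarged calculus / cut elimination) -/

/-- The sector generators: differences of `(b+1)`-dimensional representations whose last-coordinate
fibre integrals agree for a.e. base point — exactly the instances of `RelTransferOne`. -/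
def fibreOneGen : Set KZ.FormalRep :=
  {c | ∃ (b : ℕ) (r r' : KZ.IntegralRep (b + 1)),
    (∀ᵐ x : (Fin b → ℝ),
      (∫ t in {t : ℝ | (Fin.snoc x t : Fin (b + 1) → ℝ) ∈ r.domain}, r.integrand (Fin.snoc x t))
        = ∫ t in {t : ℝ | (Fin.snoc x t : Fin (b + 1) → ℝ) ∈ r'.domain}, r'.integrand (Fin.snoc x t)) ∧
    c = KZ.of r - KZ.of r'}

/-- The enlarged calculus: KZ's four moves plus the `k = 1` fibrewise-transfer rule. -/
def relationsPlusFibreOne : AddSubgroup KZ.FormalRep :=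
  AddSubgroup.closure
    ((KZ.domainAddRel ∪ KZ.integrandAddRel ∪ KZ.changeOfVariablesRel ∪ KZ.newtonLeibnizRel) ∪
      fibreOneGen)

/-- D3 residual: Conjecture 1 (semialgebraic endpoints) in the ENLARGED calculus — "the summit
modulo the `k = 1` sector" (the idiom of `AbelContraction.ReductionToDimensionOne`). -/
def ResidualModFibreOne : Prop :=
  ∀ ⦃n m : ℕ⦄ (r : KZ.IntegralRep n) (r' : KZ.IntegralRep m),
    r.value = r'.value → KZ.of r - KZ.of r' ∈ relationsPlusFibreOne

/-- KZ's moves are relations (unfolding `KZ.relations`). -/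
theorem moves_subset_relations :
    (KZ.domainAddRel ∪ KZ.integrandAddRel ∪ KZ.changeOfVariablesRel ∪ KZ.newtonLeibnizRel) ⊆
      (KZ.relations : Set KZ.FormalRep) := by
  intro c hc
  unfold KZ.relations
  exact AddSubgroup.subset_closure hc

/-- KZ's relations lie in the enlarged calculus. -/
theorem relations_le_relationsPlusFibreOne : KZ.relations ≤ relationsPlusFibreOne := by
  unfold KZ.relations relationsPlusFibreOne
  exact AddSubgroup.closure_mono subset_union_left

/-- Cut elimination: under `RelTransferOne` the fifth rule is derivable, so the enlarged calculus
collapses to KZ's. -/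
theorem relationsPlusFibreOne_le (h1 : RelTransferOne) : relationsPlusFibreOne ≤ KZ.relations := by
  refine (AddSubgroup.closure_le _).2 ?_
  rintro c (hc | ⟨b, r, r', hf, rfl⟩)
  · exact moves_subset_relations hc
  · exact h1 r r' hf

/-- **D3 is disqualified by (b): the seam residual/sector is six lines of cut elimination.**
(The remaining step `KZPeriodConjecture' → FibrewiseTransfer` is Fubini along `Fin.append`, the
open support item `SummitImpliesTransfer` (stmt-10575) — real measure theory, but independent of the
cut, so it does not make the SEAM mathematical.) -/
theorem kzPeriodConjecture'_of_residual (hres : ResidualModFibreOne) (h1 : RelTransferOne) :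
    KZPeriodConjecture' :=
  fun _ _ r r' hv => relationsPlusFibreOne_le h1 (hres r r' hv)

/-- … and by (c) in substance: the residual is implied by the summit′ outright (so, GIVEN the sector,
it is exactly as strong as the summit — `AbelContraction.ReductionToDimensionOne`'s own docstring). -/
theorem residual_of_kzPeriodConjecture' (h : KZPeriodConjecture') : ResidualModFibreOne :=
  fun _ _ r r' hv => relations_le_relationsPlusFibreOne (h r r' hv)

end Summit.KontsevichZagierPeriods.KontsevichZagierPeriods.Cruxes.FibrewiseTransfer.Census
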